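import Literature.AlgebraicGeometry.HodgeTheory.SmallChowGroupsHodgeConjecture
import Literature.AlgebraicGeometry.Motives.GeneralisedDecompositionOfTheDiagonalProofs
import Literature.AlgebraicGeometry.Motives.CorrespondenceChowAction
import Literature.AlgebraicGeometry.HodgeTheory.CorrespondenceActionHodgeClassesOfGysin
import Literature.AlgebraicGeometry.HodgeTheory.HardLefschetzNFold
import Literature.AlgebraicGeometry.HodgeTheory.CorrespondenceActionHodgeClassesOfGysinResolved
import HarnessLib

/-!
# Varieties with small Chow groups satisfy the Hodge conjecture — proof file (Laterveer 1998; Vial 2013, Thm. 7.1 (i))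

Family `hodge`, layer `Literature/AlgebraicGeometry/HodgeTheory`. Companion ("Proofs") file of
`SmallChowGroupsHodgeConjecture`, whose named fact
`Vial2013_hodgeConjectureFor_of_chowGroups_rank_le_one` (R. Laterveer, *Algebraic varieties with
small Chow groups*, J. Math. Kyoto Univ. 38 (1998), main theorem, as cited by Ch. Vial, *Algebraic
cycles and fibrations*, Doc. Math. 18 (2013), Thm. 7.1 (i): "Assume that the Chow groups
`CH₀(X_Ω), …, CH_l(X_Ω)` have niveau `≤ n`. If `n = 3` and `l = ⌊(d−4)/2⌋`, then `X` satisfies the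
Hodge conjecture", rendered with the niveau hypothesis in rank-`≤ 1` form for every algebraically
closed `L ⊇ ℂ`) is NOT discharged here. This file PROVES the printed proof: its first step
unconditionally, and the whole of it relative to the tree's existing named facts and to a given
Gysin / cycle-class formalism (fact-decomposition discipline D-0026: no new named fact; the residual
obligations are explicit hypotheses of the assembly, in the pattern of
`Literature.Barriers.HodgeConjecture.BlochSrinivas1983_hodgeConjectureDegreeFour_of_chowZeroSupported_of_gysin`
and `GysinFormalism.hodgeClassCorrespondenceAction`).

Vial 2013, proof of Thm. 7.1 (materialised text, p. 19), verbatim: "Since it is enough to prove the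
conclusion of the theorem for `X_Ω`, we may assume that `X` is defined over `Ω`. Laterveer used the
assumptions on the niveau of the Chow groups to show [Laterveer] that the diagonal `Δ_X` admits a
decomposition as follows : there exist closed and reduced subschemes `V_j, W^j ⊂ X` with
`dim V_j ≤ j + [niveau]` and `dim W^j ≤ n − j`, there exist correspondences `Γ_j ∈ CH_n(X × X)` […]
and `Γ' ∈ CH_n(X × X)` such that each `Γ_j` is in the image of the pushforward map
`CH_n(V_j × W^j)`, `Γ'` is in the image of the pushforward map `CH_n(X × W^{…})`, and
`Δ_X = Γ₀ + … + Γ_{…} + Γ'`. Given `j` […] let `Ṽ_j` and `W̃^j` denote desingularisations of `V_j`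
and `W^j` respectively. The action of `Γ_j` on `Hᵏ(X)` then factors through `Hᵏ(Ṽ_j)` and through
`H_{2n−k}(W̃^j)`. On the one hand, we have `H_{2n−k}(W̃^j) = H^{k−2j}(W̃^j)` and hence if
`k ≤ 2j+1` then the action of `Γ_j` on `Hᵏ(X)` factors through the `H⁰` or the `H¹` of a smooth
projective variety. […] On the other hand, we have `Hᵏ(Ṽ_j) = H_{4+2j−k}(Ṽ_j)` and hence if
`k ≥ 2j+2` then `Γ_j` factors through the `H_0`, the `H_1` or the `H_2` of a smooth projective
variety. Concerning the action of `Γ'` on `Hᵏ(X)`, it factors through `H_{2n−k}(W̃^{⌊(n−1)/2⌋})`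
which vanishes for dimension reasons if `k < n` […]." For niveau `0` (rank `≤ 1`) the decomposition
is exactly the generalised decomposition of the diagonal of Paranjape and Laterveer, C. Voisin,
*Hodge Theory and Complex Algebraic Geometry II* (2003), Thm. 10.29 — PROVED in the tree,
`Motives.ParanjapeLaterveer_generalisedDecompositionOfTheDiagonal_holds` — and the cohomological half
is the mechanism of Voisin II, proof of Prop. 10.26 / Thm. 10.31 run in every degree: on a rational
`(p,p)`-class `α`, `mα = Σᵢ [Z_i]^*α + [Z']^*α` with each summand the Gysin image of a Hodge class of
degree `≤ 2` on a desingularisation, or zero for dimension reasons, or supported in codimension `≥ p`.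

## Content (all proved)

* Step 0 (unconditional): `chowRankLEOneUpTo_of_chowGroups_rank_le_one` — the Chow hypothesis of
  the fact (rank `≤ 1` of `CH_i(X_L)`, `X_L = X ×_ℂ Spec L`, for every algebraically closed `L ⊇ ℂ`
  and `i ≤ ⌊(d−4)/2⌋`) implies `Motives.ChowRankLEOneUpTo X ⌊(d−4)/2⌋`: specialise to `L = ℂ` ("we
  may assume that `X` is defined over `Ω`"), transport along `X ×_ℂ Spec ℂ ≅ X`
  (`nonempty_iso_baseChange_self`; rank `≤ 1` of `CH_i` is invariant under isomorphisms of
  `ℂ`-schemes by proper push-forward, `chowGroup_rankLEOne_of_iso`, with the PROVED Fulton Thm. 1.4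
  `Motives.map_mem_ratTrivial_holds` and Stacks 02R5 `Motives.ChowGroup.pushforward_comp_holds`), and
  pass to cycles (`Motives.chowRankLEOneUpTo_iff_chowGroup`); whence
  `decompositionOfTheDiagonal_of_chowGroups_rank_le_one`: `m[Δ_X] ∼_rat Z₀ + ⋯ + Z_{k₀} + Z'`,
  `k₀ = ⌊(d−4)/2⌋`, `m > 0`, `Z_i` supported in `W'_i × W_i` (`dim W_i ≤ i`, `dim W'_i ≤ d − i`),
  `Z'` supported in `T × X`, `codim T ≥ k₀ + 1` (Voisin II, (10.16)).
* The action of the pieces, for a Gysin formalism `G` (`G.corrAct`, Voisin II (10.7)), prime cycle by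
  prime cycle (`GysinFormalism.corrAct_mem_of_primeCycle`): the support case
  `corrAct_primeCycle_mem_algebraicClasses_of_le_coheight` (`codim pr₁(z) ≥ p`: `[V]^*α ∈ Nᵖ H²ᵖ`,
  (10.8)); the vanishing case `corrAct_primeCycle_eq_zero_of_height_snd_lt` (`dim pr₂(z) < p`:
  `[V]^*α = [Ṽ]^*(j̃^*α) = 0`, (10.9), `j̃ : X̃' → pr₂`-support a projective resolution); the Lefschetz
  `(1,1)` case `corrAct_primeCycle_mem_algebraicClasses_of_coheight_add_one` (`codim pr₁(z) = p − 1`: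
  `[V]^*α = k_*([Ṽ]^*α)` with `[Ṽ]^*α` a rational `(1,1)`-class on `T̃`, (10.8), Prop. 9.21 (ii));
  assembled into `corrAct_mem_algebraicClasses_of_fst_codim` (the piece `Z'`, degrees `p ≤ codim T + 1`)
  and `corrAct_mem_algebraicClasses_of_product_support` (the pieces `Z_i`, every degree).
* `mem_algebraicClasses_of_chowGroups_rank_le_one_of_le` (Step A, `2p ≤ d`: `p ≤ k₀ + 2`, Lemma 9.18,
  `[Δ_X]^* = Id`, `m` invertible in `ℂ`), `mem_algebraicClasses_of_chowGroups_rank_le_one` (Step B,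
  `2p > d`: hard Lefschetz reduces to codimension `d − p < d/2`, the tree's
  `mem_algebraicClasses_of_lt_of_nonempty`), and the assembly
  `Vial2013_hodgeConjectureFor_of_chowGroups_rank_le_one_of_gysin`: **the fact follows from** the named
  facts `Resolution.Hironaka1964_projective` (desingularisations), `nonempty_hodgeModel` (the
  anti-vacuity conjunct of `HodgeConjectureFor`), `lefschetzOneOne_rational`, `nonempty_hardLefschetzNFold`,
  **and** a formalism `G : GysinFormalism` (hypothesis structure, taken as a PARAMETER — "the intended
  instance is to be supplied by a CONSTRUCTION", module docstring of `GysinFormalism`) with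
  `G.IsHodgeCompatible`, `PreservesHodgeType` for morphisms of smooth projective varieties and
  `CupPreservesHodgeType` (Voisin I §7.3.2, Thm. 5.29, Prop. 11.20 — the same predicates as in
  `CorrespondenceActionHodgeClassesOfGysin`). The unconditional discharge `…_holds` awaits the
  discharge of these four named facts and the construction of `G`; nothing is asserted here.
* `…_of_hodgeModel` variants, `Vial2013_hodgeConjectureFor_of_chowGroups_rank_le_one_of_isGysinHodgeCompatible`
  and `…_of_isHodgeCompatible` (sections `PrimeCyclesOfHodgeModel`, `PiecesOfHodgeModel`,
  `AssemblyOfHodgeModel`): the same proof with the two predicate hypotheses `PreservesHodgeType` /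
  `CupPreservesHodgeType` ELIMINATED — pull-backs are only taken along morphisms into `X` from
  varieties of dimension `≤ dim X`, where `IsOfHodgeType.map_of_le` (`HodgeTypePullback`) applies
  given Hodge models, and a prime correspondence acts through its desingularisation,
  `[V]^* = (τ ≫ pr₁)_* ∘ (τ ≫ pr₂)^*` (`CorrespondenceActionHodgeClassesOfGysinResolved`:
  `corrActGen_primeCycle_eq`, `isOfHodgeType_corrActGen_primeCycle`), so that neither a cup product
  with a cycle class nor any Hodge-theoretic property of `cl` is needed. The fact thereby follows
  from `G` with `G.IsGysinHodgeCompatible` (Hodge compatibility of the Gysin morphisms alone) and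
  exactly the four named facts `Resolution.Hironaka1964_projective`, `nonempty_hodgeModel`,
  `lefschetzOneOne_rational`, `nonempty_hardLefschetzNFold`.

## Remarks on the proof

* Only the `[·]^*` direction of the action is needed: the degrees `2p > d` that Laterveer/Vial treat
  through `ᵗΔ_X = Δ_X` and `H_{2n−k} = H^{k−2j}` on the desingularisations are reached here by hard
  Lefschetz on `X` itself (`L^{2p−d} : H^{2d−2p} ≅ H^{2p}` maps Hodge classes onto Hodge classes and
  algebraic classes to algebraic classes), which lands in the range `2(d−p) < d` of Step A.
* In the rank-one case the pieces `Z_i` need no Hodge conjecture on the desingularisations at all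
  (`dim W_i ≤ i ≤ codim W'_i`): either `j̃^*α = 0` or `[V]^*α` is supported in codimension `≥ p`.
  Prop. 9.20 (compatibility of `cl` with intersections) is not needed either.

## References

* [Vial2013] Ch. Vial, Algebraic cycles and fibrations, Doc. Math. 18 (2013) 1521–1553, Thm. 7.1 (i)
  and its proof, p. 19 of arXiv:1203.2650.
* [Laterveer1998] R. Laterveer, Algebraic varieties with small Chow groups, J. Math. Kyoto Univ. 38
  (1998) 673–694.
* [VoisinHodgeII2003] C. Voisin, Hodge Theory and Complex Algebraic Geometry II, CUP 2003, Thm. 10.29,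
  (10.16), Thm. 10.31, proof of Prop. 10.26 (p. 306), Lemma 9.18, Prop. 9.21, (10.7)–(10.9).
* [VoisinHodgeI2002] C. Voisin, Hodge Theory and Complex Algebraic Geometry I, §7.3.2, Thm. 6.25,
  Rem. 6.27, Thm. 11.30.
* [Kollar2007] J. Kollár, Lectures on Resolution of Singularities, Thm. 3.27.
* [Fulton1998] W. Fulton, Intersection Theory, 2nd ed., Thm. 1.4, §1.4.
* [StacksProject] The Stacks project, Tags 02R5, 02S2.
-/

noncomputable section

open CategoryTheory CategoryTheory.Limits AlgebraicGeometry MonoidalCategory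

universe u

namespace Literature.AlgebraicGeometry.HodgeTheory

open Literature.AlgebraicGeometry.Motives

section BaseChangeSelf

variable {k : Type u} [Field k]

/-- `Spec` of the structure map `k → k` of the `k`-algebra `k` is the identity of `Spec k`.
[folklore] -/
theorem specMap_ofHom_algebraMap_self (k : Type u) [Field k] :
    Spec.map (CommRingCat.ofHom (algebraMap k k)) = 𝟙 (Spec (CommRingCat.of k)) := by
  rw [Algebra.algebraMap_self, CommRingCat.ofHom_id, Spec.map_id]

/-- Hence `Spec (k → k)` is an isomorphism. [folklore] -/
theorem isIso_specMap_ofHom_algebraMap_self (k : Type u) [Field k] :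
    IsIso (Spec.map (CommRingCat.ofHom (algebraMap k k))) := by
  rw [specMap_ofHom_algebraMap_self]
  infer_instance

/-- The first projection `X ×_k Spec k → X` of the base change along the identity is an
isomorphism (pull-back of an isomorphism). [folklore] -/
theorem isIso_pullbackFst_specMap_self (X : SchemeOver k) :
    IsIso (pullback.fst X.hom (Spec.map (CommRingCat.ofHom (algebraMap k k)))) :=
  haveI := isIso_specMap_ofHom_algebraMap_self k
  (IsPullback.of_hasPullback _ _).isIso_fst_of_isIso

/-- **`X ×_k Spec k ≅ X` over `k`**: the base change `(Motives.baseChange k k).obj X` of a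
`k`-scheme along the identity of `k` is isomorphic to `X` in `SchemeOver k`, by the first
projection (Hartshorne II.3, base extension along `id`). [folklore] -/
theorem nonempty_iso_baseChange_self (X : SchemeOver k) : Nonempty ((baseChange k k).obj X ≅ X) := by
  haveI := isIso_pullbackFst_specMap_self X
  exact ⟨Over.isoMk (asIso (pullback.fst X.hom (Spec.map (CommRingCat.ofHom (algebraMap k k)))) :
      pullback X.hom (Spec.map (CommRingCat.ofHom (algebraMap k k))) ≅ X.left) (by
    change pullback.fst X.hom _ ≫ X.hom = pullback.snd X.hom _
    rw [pullback.condition]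
    exact (congrArg (pullback.snd X.hom _ ≫ ·) (specMap_ofHom_algebraMap_self k)).trans
      (Category.comp_id _))⟩

end BaseChangeSelf

section ChowRankIso

variable {k : Type u} [Field k]

/-- Proper push-forward on `CH_d` depends only on the morphism (congruence in the morphism, for
rewriting along equations such as `e⁻¹ ≫ e = 𝟙`). [folklore] -/
theorem chowGroup_pushforward_congr (d : ℕ) (h : map_mem_ratTrivial d (k := k)) {X Y : SchemeOver k}
    {f g : X ⟶ Y} [IsProper f.left] [IsProper g.left] [LocallyOfFiniteType X.hom]
    [LocallyOfFiniteType Y.hom] (hfg : f = g) :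
    ChowGroup.pushforward d h f = ChowGroup.pushforward d h g := by
  subst hfg
  rfl

/-- Along an isomorphism `e : X ≅ Y` of `k`-schemes locally of finite type, `e_* ∘ e⁻¹_* = id` on
`CH_d(Y)` (functoriality of proper push-forward, Stacks 02R5, and `id_* = id`).
[cite: StacksProject, Tag 02R5] -/
theorem chowGroup_pushforward_hom_pushforward_inv (d : ℕ) (h : map_mem_ratTrivial d (k := k))
    {X Y : SchemeOver k} (e : X ≅ Y) [LocallyOfFiniteType X.hom] [LocallyOfFiniteType Y.hom]
    (y : ChowGroup Y.left d) :
    ChowGroup.pushforward d h e.hom (ChowGroup.pushforward d h e.inv y) = y := by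
  haveI : IsProper (𝟙 Y : Y ⟶ Y).left := by
    change IsProper (𝟙 Y.left)
    infer_instance
  rw [← AddMonoidHom.comp_apply, ← ChowGroup.pushforward_comp_holds d h e.inv e.hom,
    chowGroup_pushforward_congr d h e.inv_hom_id, ChowGroup.pushforward_id]
  rfl

/-- **Rank `≤ 1` of a Chow group is invariant under isomorphisms of `k`-schemes** (locally of
finite type): if any two classes of `CH_d(X)` are `ℤ`-linearly dependent and `e : X ≅ Y` over `k`,
the same holds for `CH_d(Y)` — apply the hypothesis to `e⁻¹_* a`, `e⁻¹_* b` and push forward along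
`e` (proper push-forward, Fulton Thm. 1.4 = the tree's `Motives.map_mem_ratTrivial_holds`).
[cite: Fulton1998, Thm. 1.4] -/
theorem chowGroup_rankLEOne_of_iso {X Y : SchemeOver k} (e : X ≅ Y) [LocallyOfFiniteType X.hom]
    [LocallyOfFiniteType Y.hom] (d : ℕ)
    (hX : ∀ a b : ChowGroup X.left d, ∃ m n : ℤ, (m ≠ 0 ∨ n ≠ 0) ∧ m • a = n • b) :
    ∀ a b : ChowGroup Y.left d, ∃ m n : ℤ, (m ≠ 0 ∨ n ≠ 0) ∧ m • a = n • b := by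
  intro a b
  obtain ⟨m, n, hmn, hab⟩ := hX (ChowGroup.pushforward d (map_mem_ratTrivial_holds d) e.inv a)
    (ChowGroup.pushforward d (map_mem_ratTrivial_holds d) e.inv b)
  refine ⟨m, n, hmn, ?_⟩
  have := congrArg (ChowGroup.pushforward d (map_mem_ratTrivial_holds d) e.hom) hab
  simpa only [map_zsmul, chowGroup_pushforward_hom_pushforward_inv] using this

/-- The rank-one hypothesis on `CH_i` of the trivial base change `X ×_k Spec k` for `i ≤ k₀` gives
`Motives.ChowRankLEOneUpTo X k₀` for a `k`-scheme `X` locally of finite type (transport along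
`X ×_k Spec k ≅ X`, then Chow groups ↔ cycles, `Motives.chowRankLEOneUpTo_iff_chowGroup`).
[cite: VoisinHodgeII2003, Thm. 10.29 (hypothesis, rank-one form)] -/
theorem chowRankLEOneUpTo_of_baseChange_self {X : SchemeOver k} [LocallyOfFiniteType X.hom]
    [LocallyOfFiniteType ((baseChange k k).obj X).hom] {k₀ : ℕ}
    (h : ∀ i ≤ k₀, ∀ a b : ChowGroup ((baseChange k k).obj X).left i,
      ∃ m n : ℤ, (m ≠ 0 ∨ n ≠ 0) ∧ m • a = n • b) :
    ChowRankLEOneUpTo X k₀ := by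
  obtain ⟨e⟩ := nonempty_iso_baseChange_self X
  rw [chowRankLEOneUpTo_iff_chowGroup]
  intro j hj
  exact chowGroup_rankLEOne_of_iso e j (h j hj)

end ChowRankIso

section StepZero

/-- **Step 0 of Laterveer's proof (the Chow hypothesis of Vial 2013, Thm. 7.1 (i), rank form ⇒ the
hypothesis of Voisin II, Thm. 10.29).** For a smooth projective complex `d`-fold `X`, the Chow
hypothesis of `Vial2013_hodgeConjectureFor_of_chowGroups_rank_le_one` — rank `≤ 1` of `CH_i(X_L)`
for every algebraically closed `L ⊇ ℂ` and every `i ≤ ⌊(d−4)/2⌋` — gives, at `L = ℂ` ("we may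
assume that `X` is defined over `Ω`") and through `X ×_ℂ Spec ℂ ≅ X`, the rank-one hypothesis
`Motives.ChowRankLEOneUpTo X ⌊(d−4)/2⌋` on the cycles of `X` itself.
[cite: Vial2013, Thm 7.1 (i), proof p. 19] [cite: VoisinHodgeII2003, Thm. 10.29] -/
theorem chowRankLEOneUpTo_of_chowGroups_rank_le_one {d : ℕ} {X : SchemeOver ℂ}
    (hX : IsSmoothProjective d X)
    (hCH : ∀ (L : Type) [Field L] [IsAlgClosed L] [Algebra ℂ L] (i : ℕ), i ≤ (d - 4) / 2 →
      ∀ a b : ChowGroup ((baseChange ℂ L).obj X).left i,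
        ∃ m n : ℤ, (m ≠ 0 ∨ n ≠ 0) ∧ m • a = n • b) :
    ChowRankLEOneUpTo X ((d - 4) / 2) := by
  haveI := hX.smoothOfRelativeDimension
  haveI : Smooth X.hom := SmoothOfRelativeDimension.smooth d _
  haveI := (IsSmoothProjective.baseChange_holds ℂ hX).smoothOfRelativeDimension
  haveI : Smooth ((baseChange ℂ ℂ).obj X).hom := SmoothOfRelativeDimension.smooth d _
  exact chowRankLEOneUpTo_of_baseChange_self fun i hi a b ↦ hCH ℂ i hi a b

/-- **Step 0 ⇒ Laterveer's decomposition of the diagonal of `X` under the hypotheses of Vial 2013,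
Thm. 7.1 (i)** (Voisin II, Thm. 10.29 / (10.16), PROVED in the tree as
`Motives.ParanjapeLaterveer_generalisedDecompositionOfTheDiagonal_holds`): for `X` smooth projective
of dimension `d` over `ℂ` with the rank-`≤ 1` Chow hypothesis and every generic point `δ` of the
diagonal of `X ×_ℂ X`, `m[Δ_X] ∼_rat Z₀ + ⋯ + Z_{k₀} + Z'` as `d`-cycles, `k₀ = ⌊(d−4)/2⌋`, `m > 0`,
`Z_i` supported in `W'_i × W_i` (`dim W_i ≤ i`, `dim W'_i ≤ d − i`), `Z'` supported in `T × X` with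
`codim T ≥ k₀ + 1`. [cite: Vial2013, Thm 7.1 (i), proof p. 19]
[cite: VoisinHodgeII2003, Thm. 10.29] [cite: Laterveer1998, main theorem, as quoted in Vial2013 Thm 7.1] -/
theorem decompositionOfTheDiagonal_of_chowGroups_rank_le_one {d : ℕ} {X : SchemeOver ℂ}
    (hX : IsSmoothProjective d X)
    (hCH : ∀ (L : Type) [Field L] [IsAlgClosed L] [Algebra ℂ L] (i : ℕ), i ≤ (d - 4) / 2 →
      ∀ a b : ChowGroup ((baseChange ℂ L).obj X).left i,
        ∃ m n : ℤ, (m ≠ 0 ∨ n ≠ 0) ∧ m • a = n • b)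
    (δ : ↥(X ⊗ X).left)
    (hδ : IsGenericPoint δ (Set.range (CartesianMonoidalCategory.lift (𝟙 X) (𝟙 X)).left.base)) :
    ∃ m : ℕ, 0 < m ∧
      ∃ T : Set X.left, IsClosed T ∧ (∀ t ∈ T, (((d - 4) / 2 : ℕ) : ℕ∞) + 1 ≤ Order.coheight t) ∧
      ∃ Z' ∈ cyclesOfDim (X ⊗ X).left d,
        (∀ z, Z' z ≠ 0 → (CartesianMonoidalCategory.fst X X).left.base z ∈ T) ∧
      ∃ (Z : Fin ((d - 4) / 2 + 1) → AlgebraicCycle (X ⊗ X).left ℤ)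
        (W W' : Fin ((d - 4) / 2 + 1) → Set X.left),
        (∀ i, Z i ∈ cyclesOfDim (X ⊗ X).left d) ∧
        (∀ i, IsClosed (W i) ∧ IsClosed (W' i)) ∧
        (∀ i, ∀ w ∈ W i, Order.height w ≤ (i : ℕ)) ∧
        (∀ i, ∀ w ∈ W' i, Order.height w ≤ (d - i : ℕ)) ∧
        (∀ i z, Z i z ≠ 0 →
          (CartesianMonoidalCategory.fst X X).left.base z ∈ W' i ∧
            (CartesianMonoidalCategory.snd X X).left.base z ∈ W i) ∧
        IsRationallyEquivalent (m • primeCycle δ) ((∑ i, Z i) + Z') d :=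
  ParanjapeLaterveer_generalisedDecompositionOfTheDiagonal_holds hX
    (chowRankLEOneUpTo_of_chowGroups_rank_le_one hX hCH) δ hδ

end StepZero

end Literature.AlgebraicGeometry.HodgeTheory


namespace Literature.AlgebraicGeometry.HodgeTheory

open Literature.AlgebraicGeometry.Motives CartesianMonoidalCategory
open Literature.AlgebraicTopology.SingularHomology

section PrimeCycles

variable {n : ℕ} {X : SchemeOver ℂ}

/-- **(Support case.)** If `V = closure {z} ⊆ X ⊗ X` has `pr₁(z)` of codimension `≥ p`, then
`[V]^*c ∈ Nᵖ H²ᵖ(X(ℂ); ℂ) = algebraicClasses X p` for every `c ∈ H²ᵖ(X(ℂ); ℂ)`: `[V]^*c`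
vanishes off `closure {pr₁ z}` ((10.8) in support form), all of whose points have codimension
`≥ p`. (The case `p = 2` is the tree's
`GysinFormalism.corrAct_primeCycle_mem_algebraicClasses_of_two_le_coheight`.)
[cite: VoisinHodgeII2003, proof of Thm. 10.17 (10.8) and proof of Lemma 9.18] -/
theorem GysinFormalism.corrAct_primeCycle_mem_algebraicClasses_of_le_coheight (G : GysinFormalism)
    (hX : IsSmoothProjective n X) (z : ↥(X ⊗ X).left)
    (hz : primeCycle z ∈ cyclesOfDim (X ⊗ X).left n) {p : ℕ}
    (hp : (p : ℕ∞) ≤ Order.coheight ((fst X X).left.base z)) (c : complexBetti X (2 * p)) :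
    G.corrAct hX hX (2 * p) ⟨primeCycle z, hz⟩ c ∈ algebraicClasses X p := by
  refine mem_supportedClasses_of_restrictCompl_eq_zero (Z := closure {(fst X X).left.base z})
    isClosed_closure (fun y hy ↦ hp.trans (coheight_le_coheight_of_mem_closure hy))
    (G.restrictCompl_corrAct hX hX (2 * p) isClosed_closure ?_ c)
  intro w hw
  have hwz : w = z := by
    by_contra h
    exact hw (primeCycle_apply_of_ne h)
  rw [hwz]
  exact subset_closure rfl

/-- **(Vanishing case.)** If `V = closure {z} ⊆ X ⊗ X` is `n`-dimensional with `pr₂(z) = x'` of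
dimension `< p`, then `[V]^*α = 0` (in particular it is algebraic) for every class `α ∈ H²ᵖ(X(ℂ); ℂ)`
of Hodge type `(p,p)`: with `j̃ : X̃' → closure {x'} ⊆ X` a projective resolution
(`Resolution.Hironaka1964_projective`, hypothesis `hH`) and `[Ṽ]` the lift of `[V]` along `X ◁ j̃`,
`[V]^*α = [Ṽ]^*(j̃^*α)` ((10.9)), and `j̃^*α` is a class of type `(p,p)` (`hpull`) in degree
`2p > 2 dim X̃'`, hence `0` (`IsOfHodgeType.eq_zero_of_two_mul_lt`; Vial: the action "factors
through `H_{2n−k}(W̃^j)`, which vanishes for dimension reasons").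
[cite: Vial2013, Thm 7.1 (i), proof p. 19] [cite: VoisinHodgeII2003, proof of Thm. 10.17 (10.9)]
[cite: Kollar2007, Thm. 3.27] -/
theorem GysinFormalism.corrAct_primeCycle_eq_zero_of_height_snd_lt (G : GysinFormalism)
    (hH : Resolution.Hironaka1964_projective.{0}) (hX : IsSmoothProjective n X)
    (hpull : ∀ ⦃m : ℕ⦄ ⦃Y : SchemeOver ℂ⦄, IsSmoothProjective m Y → ∀ f : Y ⟶ X, PreservesHodgeType m n f)
    (z : ↥(X ⊗ X).left) (hz : primeCycle z ∈ cyclesOfDim (X ⊗ X).left n) (hzn : Order.height z = n)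
    {p : ℕ} (hlt : Order.height ((snd X X).left.base z) < (p : ℕ∞)) (α : complexBetti X (2 * p))
    (hpp : IsOfHodgeType n X (2 * p) p p α) :
    G.corrAct hX hX (2 * p) ⟨primeCycle z, hz⟩ α = 0 := by
  classical
  set x' := (snd X X).left.base z with hx'
  set X₀ := ClosedSubvariety.ofPoint X.left x' with hX₀
  obtain ⟨d', X₁, π, hX₁, hπ, hdim⟩ := exists_resolution_ofPoint hH hX x'
  -- `d' = dim closure {x'} < p`
  have hd'p : d' < p := by
    rw [hdim] at hlt
    exact_mod_cast hlt
  have hXX₁ := IsSmoothProjective.tensor_holds hX hX₁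
  haveI := noetherianSpace_of_isSmoothProjective hXX₁
  set j : X₁ ⟶ X := π ≫ X₀.ιOver with hj
  -- lift `[closure z]` along `X ◁ j`
  obtain ⟨z₁, hz₁, hmap⟩ := primeCycle_lift_of_isBirational_holds hX hX hX₁ X₀ j π.left rfl hπ z
    (by rw [ClosedSubvariety.genericPoint_ofPoint])
  have hz₁n : primeCycle z₁ ∈ cyclesOfDim (X ⊗ X₁).left n := primeCycle_mem_cyclesOfDim (by rw [hz₁, hzn])
  have hpush : cyclesOfDimMap n (X ◁ j).left ⟨primeCycle z₁, hz₁n⟩ = ⟨primeCycle z, hz⟩ :=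
    Subtype.ext hmap
  -- (10.9): `[V]^*α = [Ṽ]^*(j^*α)`
  rw [← hpush, G.corrAct_eq_corrActGen,
    G.corrActGen_cyclesOfDimMap_whiskerLeft hX hX hX₁ j rfl (show n + d' = n + d' from rfl) rfl
      (show 2 * p + 2 * d' = 2 * p + 2 * d' from rfl) ⟨primeCycle z₁, hz₁n⟩,
    LinearMap.comp_apply]
  -- `j^*α` is of type `(p,p)` in degree `2p > 2 dim X₁`, hence zero
  have hjα : IsOfHodgeType d' X₁ (2 * p) p p ((complexBetti.map j (2 * p)).hom α) := hpull hX₁ j hpp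
  rw [hjα.eq_zero_of_two_mul_lt (by omega), map_zero]

/-- **(Divisorial / Lefschetz `(1,1)` case.)** Let `V = closure {z} ⊆ X ⊗ X` be `n`-dimensional with
`pr₁(z) = t` of codimension `c'`, and `α ∈ H^{2(c'+1)}(X(ℂ); ℂ)` rational of type `(c'+1, c'+1)`.
With `k : T̃ → closure {t} ⊆ X` a projective resolution (`dim T̃ = n − c'`) and `[Ṽ]` the lift of
`[V]` along `k ▷ X`: `[V]^*α = k_*([Ṽ]^*α)` ((10.8)); `[Ṽ]^*α ∈ H²(T̃(ℂ); ℂ)` is rational and of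
type `(1,1)` (Hodge compatibility of `G`, of `pr_X^*` and of `∪`), hence a divisor class (Lefschetz
`(1,1)`, `h11`); and `k_*` maps `N¹ H²(T̃)` into `N^{c'+1} H^{2(c'+1)}(X)` (Prop. 9.21 (ii)). This is
Vial's "if `k ≥ 2j + 2` then `Γ_j` factors through the `H_0`, the `H_1` or the `H_2` of a smooth
projective variety" in the rank-one case; the case `c' = 1` is the tree's
`GysinFormalism.corrAct_primeCycle_mem_algebraicClasses_of_coheight_eq_one`.
[cite: Vial2013, Thm 7.1 (i), proof p. 19] [cite: VoisinHodgeII2003, proof of Prop. 10.26 (p. 306)]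
[cite: VoisinHodgeI2002, §7.3.2 and Thm. 11.30] [cite: Kollar2007, Thm. 3.27] -/
theorem GysinFormalism.corrAct_primeCycle_mem_algebraicClasses_of_coheight_add_one (G : GysinFormalism)
    (hG : G.IsHodgeCompatible) (hH : Resolution.Hironaka1964_projective.{0})
    (hX : IsSmoothProjective n X)
    (hpull : ∀ ⦃m : ℕ⦄ ⦃Y : SchemeOver ℂ⦄, IsSmoothProjective m Y → ∀ f : Y ⟶ X, PreservesHodgeType m n f)
    (hcupH : ∀ ⦃m : ℕ⦄ ⦃Y : SchemeOver ℂ⦄, IsSmoothProjective m Y → CupPreservesHodgeType m Y)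
    (h11 : lefschetzOneOne_rational) (z : ↥(X ⊗ X).left)
    (hz : primeCycle z ∈ cyclesOfDim (X ⊗ X).left n) (hzn : Order.height z = n) {c' p : ℕ}
    (hc' : Order.coheight ((fst X X).left.base z) = c') (hp : c' + 1 = p)
    (α : complexBetti X (2 * p)) (hα : IsRationalClass α) (hpp : IsOfHodgeType n X (2 * p) p p α) :
    G.corrAct hX hX (2 * p) ⟨primeCycle z, hz⟩ α ∈ algebraicClasses X p := by
  classical
  set t := (fst X X).left.base z with ht
  set T₀ := ClosedSubvariety.ofPoint X.left t with hT₀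
  obtain ⟨d', T₁, π, hT₁, hπ, hdim⟩ := exists_resolution_ofPoint hH hX t
  -- `dim T₁ + c' = n`
  have hd'n : d' + c' = n := by
    obtain ⟨a, b, ha, hb, hab⟩ := exists_height_eq_coheight_eq hX t
    rw [hdim] at ha
    rw [hc'] at hb
    have ha' : d' = a := by exact_mod_cast ha
    have hb' : c' = b := by exact_mod_cast hb
    omega
  have hT₁X := IsSmoothProjective.tensor_holds hT₁ hX
  haveI := noetherianSpace_of_isSmoothProjective hT₁X
  set kT : T₁ ⟶ X := π ≫ T₀.ιOver with hkT
  -- lift `[closure z]` along `kT ▷ X`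
  obtain ⟨z₁, hz₁, hmap⟩ := primeCycle_lift_whiskerRight_of_isBirational hX hX hT₁ T₀ kT π.left rfl
    hπ z (by rw [ClosedSubvariety.genericPoint_ofPoint])
  have hz₁n : primeCycle z₁ ∈ cyclesOfDim (T₁ ⊗ X).left n := primeCycle_mem_cyclesOfDim (by rw [hz₁, hzn])
  have hpush : cyclesOfDimMap n (kT ▷ X).left ⟨primeCycle z₁, hz₁n⟩ = ⟨primeCycle z, hz⟩ :=
    Subtype.ext hmap
  -- (10.8): `[V]^*α = k_*([Ṽ]^*α)`, `[Ṽ]^* : H^{2p}(X) → H²(T₁)`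
  rw [← hpush, G.corrAct_eq_corrActGen,
    G.corrActGen_cyclesOfDimMap_whiskerRight hX hT₁ hX kT rfl (show n + d' = d' + n by omega) rfl
      (show 2 * p + 2 * d' = 2 * 1 + 2 * n by omega) ⟨primeCycle z₁, hz₁n⟩,
    LinearMap.comp_apply]
  -- `[Ṽ]^*α` is a rational `(1,1)`-class on `T₁`, hence a divisor class; `k_*` maps `N¹ H²` to `Nᵖ H²ᵖ`
  refine G.gysin_mem_algebraicClasses hT₁ hX kT (p := 1) (q := p) (by omega) (h11 hT₁ _ ?_ ?_)
  · exact hG.isRationalClass_corrActGen hT₁ hX _ _ _ hα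
  · exact hG.isOfHodgeType_corrActGen hT₁ hX (hpull hT₁X (snd T₁ X)) (hcupH hT₁X) _ _ _
      (by omega) (by omega) hpp

end PrimeCycles

section Pieces

variable {n : ℕ} {X : SchemeOver ℂ}

/-- **The piece `Z'` of Laterveer's decomposition** (`Z'` supported in `T × X`, every point of `T` of
codimension `≥ c₀`) maps every rational `(p,p)`-class `α ∈ H²ᵖ(X(ℂ); ℂ)` with `p ≤ c₀ + 1` into
`algebraicClasses X p`: over each prime cycle `[closure z]` of `Z'`, `pr₁(z)` has codimension
`≥ c₀ ≥ p − 1`, i.e. `≥ p` (support case) or `= p − 1` (Lefschetz `(1,1)` case); then additivity.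
Vial: "Concerning the action of `Γ'` […] it factors through `H_{2n−k}(W̃^{…})`", here in the
`[·]^*` direction through the Gysin morphism of `T̃`, landing in `H⁰` or `H²`.
[cite: Vial2013, Thm 7.1 (i), proof p. 19] [cite: VoisinHodgeII2003, proof of Prop. 10.26 (p. 306)] -/
theorem GysinFormalism.corrAct_mem_algebraicClasses_of_fst_codim (G : GysinFormalism)
    (hG : G.IsHodgeCompatible) (hH : Resolution.Hironaka1964_projective.{0})
    (hX : IsSmoothProjective n X)
    (hpull : ∀ ⦃m : ℕ⦄ ⦃Y : SchemeOver ℂ⦄, IsSmoothProjective m Y → ∀ f : Y ⟶ X, PreservesHodgeType m n f)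
    (hcupH : ∀ ⦃m : ℕ⦄ ⦃Y : SchemeOver ℂ⦄, IsSmoothProjective m Y → CupPreservesHodgeType m Y)
    (h11 : lefschetzOneOne_rational) {Z : ↥(cyclesOfDim (X ⊗ X).left n)} {T : Set X.left} {c₀ : ℕ}
    (hT : ∀ t ∈ T, (c₀ : ℕ∞) ≤ Order.coheight t)
    (hZ : ∀ z, (Z : AlgebraicCycle (X ⊗ X).left ℤ) z ≠ 0 → (fst X X).left.base z ∈ T)
    {p : ℕ} (hp : p ≤ c₀ + 1)
    (α : complexBetti X (2 * p)) (hα : IsRationalClass α) (hpp : IsOfHodgeType n X (2 * p) p p α) :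
    G.corrAct hX hX (2 * p) Z α ∈ algebraicClasses X p := by
  refine G.corrAct_mem_of_primeCycle hX hX (2 * p) _ Z α fun z hz0 hz ↦ ?_
  obtain ⟨a, b, -, hb, -⟩ := exists_height_eq_coheight_eq hX ((fst X X).left.base z)
  have hc₀b : c₀ ≤ b := by
    have h := hT _ (hZ z hz0)
    rw [hb] at h
    exact_mod_cast h
  by_cases hpb : p ≤ b
  · exact G.corrAct_primeCycle_mem_algebraicClasses_of_le_coheight hX z hz
      (by rw [hb]; exact_mod_cast hpb) α
  · exact G.corrAct_primeCycle_mem_algebraicClasses_of_coheight_add_one hG hH hX hpull hcupH h11 z hz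
      (Z.2 z hz0) hb (show b + 1 = p by omega) α hα hpp

/-- **The pieces `Z_i` of Laterveer's decomposition** (`Z_i` supported in `W'_i × W_i`,
`dim W_i ≤ i ≤ n`, `dim W'_i ≤ n − i`) map EVERY class `α ∈ H²ᵖ(X(ℂ); ℂ)` of Hodge type `(p,p)`
into `algebraicClasses X p`: over a prime cycle `[closure z]` of `Z_i`, either `dim pr₂(z) < p` and
`[closure z]^*α = 0` (vanishing case), or `p ≤ dim pr₂(z) ≤ i ≤ codim pr₁(z)` (support case). Vial:
"if `k ≤ 2j+1` then the action of `Γ_j` on `Hᵏ(X)` factors through the `H⁰` or the `H¹`" / "if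
`k ≥ 2j+2` then `Γ_j` factors through …" — in the rank-one (niveau `0`) case the two ranges need no
Hodge conjecture at all. [cite: Vial2013, Thm 7.1 (i), proof p. 19]
[cite: VoisinHodgeII2003, Thm. 10.29 and proof of Thm. 10.31] -/
theorem GysinFormalism.corrAct_mem_algebraicClasses_of_product_support (G : GysinFormalism)
    (hH : Resolution.Hironaka1964_projective.{0}) (hX : IsSmoothProjective n X)
    (hpull : ∀ ⦃m : ℕ⦄ ⦃Y : SchemeOver ℂ⦄, IsSmoothProjective m Y → ∀ f : Y ⟶ X, PreservesHodgeType m n f)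
    {Z : ↥(cyclesOfDim (X ⊗ X).left n)} {W W' : Set X.left} {i : ℕ} (hi : i ≤ n)
    (hW : ∀ w ∈ W, Order.height w ≤ (i : ℕ)) (hW' : ∀ w ∈ W', Order.height w ≤ (n - i : ℕ))
    (hZ : ∀ z, (Z : AlgebraicCycle (X ⊗ X).left ℤ) z ≠ 0 →
      (fst X X).left.base z ∈ W' ∧ (snd X X).left.base z ∈ W)
    {p : ℕ} (α : complexBetti X (2 * p)) (hpp : IsOfHodgeType n X (2 * p) p p α) :
    G.corrAct hX hX (2 * p) Z α ∈ algebraicClasses X p := by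
  refine G.corrAct_mem_of_primeCycle hX hX (2 * p) _ Z α fun z hz0 hz ↦ ?_
  by_cases hlt : Order.height ((snd X X).left.base z) < (p : ℕ∞)
  · rw [G.corrAct_primeCycle_eq_zero_of_height_snd_lt hH hX hpull z hz (Z.2 z hz0) hlt α hpp]
    exact Submodule.zero_mem _
  · refine G.corrAct_primeCycle_mem_algebraicClasses_of_le_coheight hX z hz ?_ α
    obtain ⟨a, b, ha, hb, hab⟩ := exists_height_eq_coheight_eq hX ((fst X X).left.base z)
    obtain ⟨a₂, b₂, ha₂, -, hab₂⟩ := exists_height_eq_coheight_eq hX ((snd X X).left.base z)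
    have h1 := hW' _ (hZ z hz0).1
    have h2 := hW _ (hZ z hz0).2
    rw [ha] at h1
    rw [ha₂] at h2 hlt
    rw [hb]
    have h1' : a ≤ n - i := by exact_mod_cast h1
    have h2' : a₂ ≤ i := by exact_mod_cast h2
    have hlt' : p ≤ a₂ := by
      by_contra h
      exact hlt (by exact_mod_cast (not_le.mp h))
    exact_mod_cast (show p ≤ b by omega)

end Pieces

section Assembly

variable {n : ℕ} {X : SchemeOver ℂ}

/-- **Laterveer's theorem below the middle degree (Step A), for a Hodge-compatible Gysin formalism,
from the printed ingredients.** Let `X` be a smooth projective complex `n`-fold satisfying the Chow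
hypothesis of `Vial2013_hodgeConjectureFor_of_chowGroups_rank_le_one`. Then every rational
`(p,p)`-class `α ∈ H²ᵖ(X(ℂ); ℂ)` with `p ≤ ⌊(n−4)/2⌋ + 2` is algebraic: by Step 0 and Voisin II,
Thm. 10.29, `m[Δ_X] ∼ Σ Z_i + Z'` (`decompositionOfTheDiagonal_of_chowGroups_rank_le_one`); by
Lemma 9.18 and `[Δ_X]^* = Id`, `mα = Σ [Z_i]^*α + [Z']^*α`; each `[Z_i]^*α` is algebraic
(`corrAct_mem_algebraicClasses_of_product_support`) and so is `[Z']^*α` (`codim T ≥ k₀ + 1 ≥ p − 1`,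
`corrAct_mem_algebraicClasses_of_fst_codim`); and `m ≠ 0` is invertible in `ℂ`. Hypotheses: the
named facts projective Hironaka (`hH`) and Lefschetz `(1,1)` (`h11`), and the predicates `hG`,
`hpull`, `hcupH` on the given formalism `G`. [cite: Vial2013, Thm 7.1 (i), proof p. 19]
[cite: VoisinHodgeII2003, Thm. 10.29, Lemma 9.18 and proof of Prop. 10.26]
[cite: Laterveer1998, main theorem, as quoted in Vial2013 Thm 7.1] -/
theorem mem_algebraicClasses_of_chowGroups_rank_le_one_of_le (G : GysinFormalism)
    (hG : G.IsHodgeCompatible) (hH : Resolution.Hironaka1964_projective.{0})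
    (h11 : lefschetzOneOne_rational) (hX : IsSmoothProjective n X)
    (hpull : ∀ ⦃m : ℕ⦄ ⦃Y : SchemeOver ℂ⦄, IsSmoothProjective m Y → ∀ f : Y ⟶ X, PreservesHodgeType m n f)
    (hcupH : ∀ ⦃m : ℕ⦄ ⦃Y : SchemeOver ℂ⦄, IsSmoothProjective m Y → CupPreservesHodgeType m Y)
    (hCH : ∀ (L : Type) [Field L] [IsAlgClosed L] [Algebra ℂ L] (i : ℕ), i ≤ (n - 4) / 2 →
      ∀ a b : ChowGroup ((baseChange ℂ L).obj X).left i,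
        ∃ m n : ℤ, (m ≠ 0 ∨ n ≠ 0) ∧ m • a = n • b)
    {p : ℕ} (hp : p ≤ (n - 4) / 2 + 2) (α : complexBetti X (2 * p)) (hα : IsRationalClass α)
    (hpp : IsOfHodgeType n X (2 * p) p p α) : α ∈ algebraicClasses X p := by
  classical
  -- a generic point `δ` of the diagonal, and `[Δ]` as an `n`-cycle
  haveI := GysinFormalism.isClosedImmersion_diagonal_left hX
  haveI := irreducibleSpace_of_isSmoothProjective' hX
  set Δ := (lift (𝟙 X) (𝟙 X)).left with hΔ
  obtain ⟨δ, hδ⟩ : ∃ δ : ↥(X ⊗ X).left, IsGenericPoint δ (Set.range Δ.base) := by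
    refine ⟨Δ.base (genericPoint X.left), ?_⟩
    have h := (genericPoint_spec X.left).image Δ.base.hom.continuous
    rwa [Set.image_univ, Δ.isClosedEmbedding.isClosed_range.closure_eq] at h
  have hn : primeCycle δ ∈ cyclesOfDim (X ⊗ X).left n :=
    primeCycle_mem_cyclesOfDim (height_eq_of_isGenericPoint_diagonal' hX hδ)
  -- Laterveer's decomposition `m[Δ] ∼ Σ Z_i + Z'`
  obtain ⟨m, hm, T, -, hcod, Z', hZ', hZ'T, Z, W, W', hZ, -, hWdim, hW'dim, hsupp, hrat⟩ :=
    decompositionOfTheDiagonal_of_chowGroups_rank_le_one hX hCH δ hδ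
  set Zs : Fin ((n - 4) / 2 + 1) → ↥(cyclesOfDim (X ⊗ X).left n) := fun i ↦ ⟨Z i, hZ i⟩ with hZs
  have hrat' : IsRationallyEquivalent
      ((m • ⟨primeCycle δ, hn⟩ : ↥(cyclesOfDim (X ⊗ X).left n)) : AlgebraicCycle (X ⊗ X).left ℤ)
      (((∑ i, Zs i) + ⟨Z', hZ'⟩ : ↥(cyclesOfDim (X ⊗ X).left n)) : AlgebraicCycle (X ⊗ X).left ℤ) n := by
    rw [AddSubgroup.coe_add, AddSubmonoidClass.coe_finsetSum]
    exact hrat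
  -- Lemma 9.18 and `[Δ]^* = Id`: `m • α = Σ [Z_i]^*α + [Z']^*α`
  have hact := G.corrAct_congr hX hX (2 * p) hrat'
  rw [map_nsmul, map_add, map_sum, G.corrAct_primeCycle_diagonal hX (2 * p) δ hδ hn] at hact
  have hmα : (m : ℂ) • α = ∑ i, G.corrAct hX hX (2 * p) (Zs i) α + G.corrAct hX hX (2 * p) ⟨Z', hZ'⟩ α := by
    have h := LinearMap.congr_fun hact α
    simp only [LinearMap.smul_apply, LinearMap.id_apply, LinearMap.add_apply,
      LinearMap.coe_sum, Finset.sum_apply] at h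
    rw [← h, Nat.cast_smul_eq_nsmul ℂ m α]
  -- every summand is algebraic
  have hmem : (m : ℂ) • α ∈ algebraicClasses X p := by
    rw [hmα]
    refine add_mem (Submodule.sum_mem _ fun i _ ↦ ?_) ?_
    · exact G.corrAct_mem_algebraicClasses_of_product_support hH hX hpull (i := (i : ℕ)) (by omega)
        (hWdim i) (hW'dim i) (hsupp i) α hpp
    · exact G.corrAct_mem_algebraicClasses_of_fst_codim hG hH hX hpull hcupH h11 (c₀ := (n - 4) / 2 + 1)
        (fun t ht ↦ by exact_mod_cast hcod t ht) hZ'T (by omega) α hα hpp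
  -- and `m` is invertible in `ℂ`
  have hm0 : (m : ℂ) ≠ 0 := by exact_mod_cast hm.ne'
  rwa [Submodule.smul_mem_iff _ hm0] at hmem

/-- **Laterveer's theorem in every degree (Steps A and B)**: under the hypotheses of
`mem_algebraicClasses_of_chowGroups_rank_le_one_of_le` and the hard Lefschetz theorem for `X`
(named fact `nonempty_hardLefschetzNFold n X`, hypothesis `hHL`), every rational `(p,p)`-class of
`H²ᵖ(X(ℂ); ℂ)` is algebraic: for `2p ≤ n`, `p ≤ ⌊n/2⌋ = ⌊(n−4)/2⌋ + 2` (Step A); for `2p > n` the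
Lefschetz isomorphism `L^{2p−n} : H^{2n−2p}(X, ℚ) ≅ H^{2p}(X, ℚ)` reduces to codimension `n − p`,
where `2(n−p) < n` (the tree's `mem_algebraicClasses_of_lt_of_nonempty`; Vial: "we have
`H_{2n−k}(W̃^j) = H^{k−2j}(W̃^j)`", Poincaré–Lefschetz duality on the desingularisations, here run
on `X` itself). [cite: Vial2013, Thm 7.1 (i), proof p. 19] [cite: VoisinHodgeI2002, Thm. 6.25 and Rem. 6.27]
[cite: Laterveer1998, main theorem, as quoted in Vial2013 Thm 7.1] -/
theorem mem_algebraicClasses_of_chowGroups_rank_le_one (G : GysinFormalism)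
    (hG : G.IsHodgeCompatible) (hH : Resolution.Hironaka1964_projective.{0})
    (h11 : lefschetzOneOne_rational) (hX : IsSmoothProjective n X) (hHL : nonempty_hardLefschetzNFold n X)
    (hpull : ∀ ⦃m : ℕ⦄ ⦃Y : SchemeOver ℂ⦄, IsSmoothProjective m Y → ∀ f : Y ⟶ X, PreservesHodgeType m n f)
    (hcupH : ∀ ⦃m : ℕ⦄ ⦃Y : SchemeOver ℂ⦄, IsSmoothProjective m Y → CupPreservesHodgeType m Y)
    (hCH : ∀ (L : Type) [Field L] [IsAlgClosed L] [Algebra ℂ L] (i : ℕ), i ≤ (n - 4) / 2 →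
      ∀ a b : ChowGroup ((baseChange ℂ L).obj X).left i,
        ∃ m n : ℤ, (m ≠ 0 ∨ n ≠ 0) ∧ m • a = n • b)
    (p : ℕ) (α : complexBetti X (2 * p)) (hα : IsRationalClass α) (hpp : IsOfHodgeType n X (2 * p) p p α) :
    α ∈ algebraicClasses X p := by
  by_cases h2p : 2 * p ≤ n
  · exact mem_algebraicClasses_of_chowGroups_rank_le_one_of_le G hG hH h11 hX hpull hcupH hCH
      (by omega) α hα hpp
  · exact mem_algebraicClasses_of_lt_of_nonempty hHL hX (by omega)
      (fun c hc hc' ↦ mem_algebraicClasses_of_chowGroups_rank_le_one_of_le G hG hH h11 hX hpull hcupH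
        hCH (by omega) c hc hc') α hα hpp

/-- **Assembly: Vial 2013, Thm. 7.1 (i) / Laterveer 1998 on the tree's carriers,
`Vial2013_hodgeConjectureFor_of_chowGroups_rank_le_one`, follows from its printed ingredients** —
the generalised decomposition of the diagonal (PROVED, `Motives.ParanjapeLaterveer_generalisedDecompositionOfTheDiagonal_holds`),
the named facts projective Hironaka (`Resolution.Hironaka1964_projective`, desingularisations of the
supports), Hodge models of smooth projective varieties (`nonempty_hodgeModel`, the anti-vacuity
conjunct of `HodgeConjectureFor`), the Lefschetz theorem on `(1,1)`-classes
(`lefschetzOneOne_rational`) and the hard Lefschetz theorem (`nonempty_hardLefschetzNFold`), and a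
Gysin / cycle-class formalism on `H*(–(ℂ); ℂ)` (`G : GysinFormalism`, a hypothesis structure taken as
a PARAMETER — its intended instance is to be supplied by a construction, module docstring of
`GysinFormalism`) which is Hodge compatible (`G.IsHodgeCompatible`: `f_*`, `cl` rational and of the
printed bidegrees, Voisin I §7.3.2, Prop. 11.20) together with "pull-backs and cup products are
morphisms of Hodge structures" (`PreservesHodgeType`, `CupPreservesHodgeType`, Voisin I §7.3.2,
Thm. 5.29). Nothing is asserted: the unconditional discharge `…_holds` awaits the discharge of the
four named facts and the construction of `G`. [cite: Vial2013, Thm 7.1 (i)]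
[cite: Laterveer1998, main theorem, as quoted in Vial2013 Thm 7.1]
[cite: VoisinHodgeII2003, Thm. 10.29, Thm. 10.31 and proof of Prop. 10.26] -/
theorem Vial2013_hodgeConjectureFor_of_chowGroups_rank_le_one_of_gysin (G : GysinFormalism)
    (hG : G.IsHodgeCompatible) (hH : Resolution.Hironaka1964_projective.{0})
    (hM : ∀ (m : ℕ) (Y : SchemeOver ℂ), nonempty_hodgeModel m Y) (h11 : lefschetzOneOne_rational)
    (hHL : ∀ (m : ℕ) (Y : SchemeOver ℂ), nonempty_hardLefschetzNFold m Y)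
    (hpull : ∀ ⦃m n : ℕ⦄ ⦃Y X : SchemeOver ℂ⦄, IsSmoothProjective m Y → IsSmoothProjective n X →
      ∀ f : Y ⟶ X, PreservesHodgeType m n f)
    (hcupH : ∀ ⦃m : ℕ⦄ ⦃Y : SchemeOver ℂ⦄, IsSmoothProjective m Y → CupPreservesHodgeType m Y) :
    Vial2013_hodgeConjectureFor_of_chowGroups_rank_le_one := by
  intro d X hX hCH
  exact ⟨hM d X hX, fun p α hα hpp ↦ mem_algebraicClasses_of_chowGroups_rank_le_one G hG hH h11 hX
    (hHL d X) (fun m Y hY f ↦ hpull hY hX f) hcupH hCH p α hα hpp⟩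

end Assembly

/-! ### The same proof with Hodge models in place of the predicates `hpull`, `hcupH`

The lemmas of the sections `PrimeCycles`, `Pieces` and `Assembly` above take "pull-backs preserve
Hodge types" (`PreservesHodgeType`, hypothesis `hpull`) and "cup products respect the Hodge
bigrading" (`CupPreservesHodgeType`, hypothesis `hcupH`) as explicit predicate hypotheses. Both are
dispensable: the only pull-backs needed are along morphisms INTO `X` from varieties of dimension
`≤ dim X` (desingularisations of subvarieties of `X`, and of prime `n`-cycles of `T̃ ⊗ X`), for
which `IsOfHodgeType.map_of_le` (file `HodgeTypePullback`: Voisin I §7.3.2 on the tree's carriers)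
needs nothing beyond a Hodge model of the source (`nonempty_hodgeModel`, hypothesis `hM`, already an
ingredient of the assembly); and the cup product `pr_X^* α ∪ cl Z` is avoided altogether by letting a
prime correspondence act through its desingularisation, `[V]^* = (τ ≫ pr₁)_* ∘ (τ ≫ pr₂)^*` (file
`CorrespondenceActionHodgeClassesOfGysinResolved`: `GysinFormalism.corrActGen_primeCycle_eq`,
`IsGysinHodgeCompatible.isOfHodgeType_corrActGen_primeCycle`), which moreover uses only the Hodge
compatibility of the Gysin morphisms (`G.IsGysinHodgeCompatible`), not of the cycle class. The
variants below (`…_of_hodgeModel`) thus reduce the fact to a formalism `G` with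
`G.IsGysinHodgeCompatible` and the four named facts `Resolution.Hironaka1964_projective`,
`nonempty_hodgeModel`, `lefschetzOneOne_rational`, `nonempty_hardLefschetzNFold` — nothing else
(`Vial2013_hodgeConjectureFor_of_chowGroups_rank_le_one_of_isGysinHodgeCompatible`). -/

section PrimeCyclesOfHodgeModel

variable {n : ℕ} {X : SchemeOver ℂ}

/-- **(Vanishing case, from Hodge models.)** If `V = closure {z} ⊆ X ⊗ X` is `n`-dimensional with
`pr₂(z) = x'` of dimension `< p`, then `[V]^*α = 0` for every class `α ∈ H²ᵖ(X(ℂ); ℂ)` of Hodge type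
`(p,p)`: with `j̃ : X̃' → closure {x'} ⊆ X` a projective resolution (`hH`), `[V]^*α = [Ṽ]^*(j̃^*α)`
((10.9)), and `j̃^*α` is of type `(p,p)` on `X̃'` (`IsOfHodgeType.map_of_le`, `dim X̃' ≤ dim X`, a
Hodge model of `X̃'` from `hM`) in degree `2p > 2 dim X̃'`, hence `0`. The variant of
`corrAct_primeCycle_eq_zero_of_height_snd_lt` with `hM` in place of `hpull`.
[cite: Vial2013, Thm 7.1 (i), proof p. 19] [cite: VoisinHodgeII2003, proof of Thm. 10.17 (10.9)]
[cite: VoisinHodgeI2002, §7.3.2] [cite: Kollar2007, Thm. 3.27] -/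
theorem GysinFormalism.corrAct_primeCycle_eq_zero_of_height_snd_lt_of_hodgeModel (G : GysinFormalism)
    (hH : Resolution.Hironaka1964_projective.{0})
    (hM : ∀ (m : ℕ) (Y : SchemeOver ℂ), nonempty_hodgeModel m Y) (hX : IsSmoothProjective n X)
    (z : ↥(X ⊗ X).left) (hz : primeCycle z ∈ cyclesOfDim (X ⊗ X).left n) (hzn : Order.height z = n)
    {p : ℕ} (hlt : Order.height ((snd X X).left.base z) < (p : ℕ∞)) (α : complexBetti X (2 * p))
    (hpp : IsOfHodgeType n X (2 * p) p p α) :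
    G.corrAct hX hX (2 * p) ⟨primeCycle z, hz⟩ α = 0 := by
  classical
  set x' := (snd X X).left.base z with hx'
  set X₀ := ClosedSubvariety.ofPoint X.left x' with hX₀
  obtain ⟨d', X₁, π, hX₁, hπ, hdim⟩ := exists_resolution_ofPoint hH hX x'
  -- `d' = dim closure {x'} < p` and `d' ≤ n`
  have hd'p : d' < p := by
    rw [hdim] at hlt
    exact_mod_cast hlt
  have hd'n : d' ≤ n := by
    obtain ⟨a, b, ha, -, hab⟩ := exists_height_eq_coheight_eq hX x'
    rw [hdim] at ha
    have ha' : d' = a := by exact_mod_cast ha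
    omega
  have hXX₁ := IsSmoothProjective.tensor_holds hX hX₁
  haveI := noetherianSpace_of_isSmoothProjective hXX₁
  set j : X₁ ⟶ X := π ≫ X₀.ιOver with hj
  -- lift `[closure z]` along `X ◁ j`
  obtain ⟨z₁, hz₁, hmap⟩ := primeCycle_lift_of_isBirational_holds hX hX hX₁ X₀ j π.left rfl hπ z
    (by rw [ClosedSubvariety.genericPoint_ofPoint])
  have hz₁n : primeCycle z₁ ∈ cyclesOfDim (X ⊗ X₁).left n := primeCycle_mem_cyclesOfDim (by rw [hz₁, hzn])
  have hpush : cyclesOfDimMap n (X ◁ j).left ⟨primeCycle z₁, hz₁n⟩ = ⟨primeCycle z, hz⟩ :=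
    Subtype.ext hmap
  -- (10.9): `[V]^*α = [Ṽ]^*(j^*α)`
  rw [← hpush, G.corrAct_eq_corrActGen,
    G.corrActGen_cyclesOfDimMap_whiskerLeft hX hX hX₁ j rfl (show n + d' = n + d' from rfl) rfl
      (show 2 * p + 2 * d' = 2 * p + 2 * d' from rfl) ⟨primeCycle z₁, hz₁n⟩,
    LinearMap.comp_apply]
  -- `j^*α` is of type `(p,p)` in degree `2p > 2 dim X₁`, hence zero
  obtain ⟨B⟩ := (hM d' X₁).nonempty hX₁
  have hjα : IsOfHodgeType d' X₁ (2 * p) p p ((complexBetti.map j (2 * p)).hom α) :=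
    hpp.map_of_le hX₁ hX B j hd'n
  rw [hjα.eq_zero_of_two_mul_lt (by omega), map_zero]

/-- **(Divisorial / Lefschetz `(1,1)` case, from Hodge models.)** Let `V = closure {z} ⊆ X ⊗ X` be
`n`-dimensional with `pr₁(z) = t` of codimension `c'`, and `α ∈ H^{2(c'+1)}(X(ℂ); ℂ)` rational of type
`(c'+1, c'+1)`. With `k : T̃ → closure {t} ⊆ X` a projective resolution and `[Ṽ]` the lift of `[V]`
along `k ▷ X`: `[V]^*α = k_*([Ṽ]^*α)` ((10.8)); `[Ṽ]^*α ∈ H²(T̃(ℂ); ℂ)` is rational and of type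
`(1,1)` — both computed through a desingularisation `τ` of `Ṽ`, `[Ṽ]^*α = (τ ≫ pr₁)_*((τ ≫ pr₂)^*α)`
(`CorrespondenceActionHodgeClassesOfGysinResolved`: `isRationalClass_corrActGen_primeCycle`,
`isOfHodgeType_corrActGen_primeCycle`; `Ṽ` is an `n`-cycle of `T̃ ⊗ X`, `n ≤ dim X`, so only the Hodge
compatibility of the Gysin morphisms, `G.IsGysinHodgeCompatible`, and a Hodge model of the resolution
are used) — hence a divisor class (Lefschetz `(1,1)`, `h11`); and `k_*` maps `N¹ H²(T̃)` into
`N^{c'+1} H^{2(c'+1)}(X)`. The variant of `corrAct_primeCycle_mem_algebraicClasses_of_coheight_add_one`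
with `hM` in place of `hpull`, `hcupH` and `IsGysinHodgeCompatible` in place of `IsHodgeCompatible`.
[cite: Vial2013, Thm 7.1 (i), proof p. 19] [cite: VoisinHodgeII2003, proof of Prop. 10.26 (p. 306)]
[cite: VoisinHodgeI2002, §7.3.2 and Thm. 11.30] [cite: Kollar2007, Thm. 3.27] -/
theorem GysinFormalism.corrAct_primeCycle_mem_algebraicClasses_of_coheight_add_one_of_hodgeModel
    (G : GysinFormalism) (hG : G.IsGysinHodgeCompatible) (hH : Resolution.Hironaka1964_projective.{0})
    (hM : ∀ (m : ℕ) (Y : SchemeOver ℂ), nonempty_hodgeModel m Y) (h11 : lefschetzOneOne_rational)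
    (hX : IsSmoothProjective n X) (z : ↥(X ⊗ X).left)
    (hz : primeCycle z ∈ cyclesOfDim (X ⊗ X).left n) (hzn : Order.height z = n) {c' p : ℕ}
    (hc' : Order.coheight ((fst X X).left.base z) = c') (hp : c' + 1 = p)
    (α : complexBetti X (2 * p)) (hα : IsRationalClass α) (hpp : IsOfHodgeType n X (2 * p) p p α) :
    G.corrAct hX hX (2 * p) ⟨primeCycle z, hz⟩ α ∈ algebraicClasses X p := by
  classical
  set t := (fst X X).left.base z with ht
  set T₀ := ClosedSubvariety.ofPoint X.left t with hT₀
  obtain ⟨d', T₁, π, hT₁, hπ, hdim⟩ := exists_resolution_ofPoint hH hX t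
  -- `dim T₁ + c' = n`
  have hd'n : d' + c' = n := by
    obtain ⟨a, b, ha, hb, hab⟩ := exists_height_eq_coheight_eq hX t
    rw [hdim] at ha
    rw [hc'] at hb
    have ha' : d' = a := by exact_mod_cast ha
    have hb' : c' = b := by exact_mod_cast hb
    omega
  have hT₁X := IsSmoothProjective.tensor_holds hT₁ hX
  haveI := noetherianSpace_of_isSmoothProjective hT₁X
  set kT : T₁ ⟶ X := π ≫ T₀.ιOver with hkT
  -- lift `[closure z]` along `kT ▷ X`
  obtain ⟨z₁, hz₁, hmap⟩ := primeCycle_lift_whiskerRight_of_isBirational hX hX hT₁ T₀ kT π.left rfl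
    hπ z (by rw [ClosedSubvariety.genericPoint_ofPoint])
  have hz₁n : primeCycle z₁ ∈ cyclesOfDim (T₁ ⊗ X).left n := primeCycle_mem_cyclesOfDim (by rw [hz₁, hzn])
  have hpush : cyclesOfDimMap n (kT ▷ X).left ⟨primeCycle z₁, hz₁n⟩ = ⟨primeCycle z, hz⟩ :=
    Subtype.ext hmap
  -- (10.8): `[V]^*α = k_*([Ṽ]^*α)`, `[Ṽ]^* : H^{2p}(X) → H²(T₁)`
  rw [← hpush, G.corrAct_eq_corrActGen,
    G.corrActGen_cyclesOfDimMap_whiskerRight hX hT₁ hX kT rfl (show n + d' = d' + n by omega) rfl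
      (show 2 * p + 2 * d' = 2 * 1 + 2 * n by omega) ⟨primeCycle z₁, hz₁n⟩,
    LinearMap.comp_apply]
  -- a projective resolution `τ : Ṽ → T₁ ⊗ X` of `closure {z₁}` (`dim Ṽ = n`), `τ_*[Ṽ] = [closure {z₁}]`
  obtain ⟨V, τ, η, hV, hηg, hηn, hτ⟩ := exists_resolution_primeCycle hH hT₁X z₁ (show Order.height z₁ = n by
    rw [hz₁, hzn])
  haveI := isProper_left_of_isSmoothProjective hV hT₁X τ
  have hη : primeCycle η ∈ cyclesOfDim V.left n := primeCycle_mem_cyclesOfDim hηn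
  have hτ' : cyclesOfDimMap n τ.left ⟨primeCycle η, hη⟩ = ⟨primeCycle z₁, hz₁n⟩ := Subtype.ext hτ
  obtain ⟨B⟩ := (hM n V).nonempty hV
  -- `[Ṽ]^*α = (τ ≫ pr₁)_* ((τ ≫ pr₂)^* α)` is a rational `(1,1)`-class on `T₁`, hence a divisor class;
  -- `k_*` maps `N¹ H²` to `Nᵖ H²ᵖ`
  refine G.gysin_mem_algebraicClasses hT₁ hX kT (p := 1) (q := p) (by omega) (h11 hT₁ _ ?_ ?_)
  · exact hG.isRationalClass_corrActGen_primeCycle hT₁ hX _ _ z₁ hz₁n hV τ η hηg hη hτ' hα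
  · exact hG.isOfHodgeType_corrActGen_primeCycle hT₁ hX _ _ z₁ hz₁n hV τ η hηg hη hτ' B le_rfl
      (by omega) (by omega) hpp

end PrimeCyclesOfHodgeModel

section PiecesOfHodgeModel

variable {n : ℕ} {X : SchemeOver ℂ}

/-- **The piece `Z'` of Laterveer's decomposition, from Hodge models** (`Z'` supported in `T × X`,
every point of `T` of codimension `≥ c₀`): every rational `(p,p)`-class `α ∈ H²ᵖ(X(ℂ); ℂ)` with
`p ≤ c₀ + 1` is mapped into `algebraicClasses X p` (support case or Lefschetz `(1,1)` case over each
prime cycle, then additivity). The variant of `corrAct_mem_algebraicClasses_of_fst_codim` with `hM` in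
place of `hpull`, `hcupH`. [cite: Vial2013, Thm 7.1 (i), proof p. 19] [cite: VoisinHodgeII2003, proof of Prop. 10.26 (p. 306)] -/
theorem GysinFormalism.corrAct_mem_algebraicClasses_of_fst_codim_of_hodgeModel (G : GysinFormalism)
    (hG : G.IsGysinHodgeCompatible) (hH : Resolution.Hironaka1964_projective.{0})
    (hM : ∀ (m : ℕ) (Y : SchemeOver ℂ), nonempty_hodgeModel m Y) (h11 : lefschetzOneOne_rational)
    (hX : IsSmoothProjective n X) {Z : ↥(cyclesOfDim (X ⊗ X).left n)} {T : Set X.left} {c₀ : ℕ}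
    (hT : ∀ t ∈ T, (c₀ : ℕ∞) ≤ Order.coheight t)
    (hZ : ∀ z, (Z : AlgebraicCycle (X ⊗ X).left ℤ) z ≠ 0 → (fst X X).left.base z ∈ T)
    {p : ℕ} (hp : p ≤ c₀ + 1)
    (α : complexBetti X (2 * p)) (hα : IsRationalClass α) (hpp : IsOfHodgeType n X (2 * p) p p α) :
    G.corrAct hX hX (2 * p) Z α ∈ algebraicClasses X p := by
  refine G.corrAct_mem_of_primeCycle hX hX (2 * p) _ Z α fun z hz0 hz ↦ ?_
  obtain ⟨a, b, -, hb, -⟩ := exists_height_eq_coheight_eq hX ((fst X X).left.base z)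
  have hc₀b : c₀ ≤ b := by
    have h := hT _ (hZ z hz0)
    rw [hb] at h
    exact_mod_cast h
  by_cases hpb : p ≤ b
  · exact G.corrAct_primeCycle_mem_algebraicClasses_of_le_coheight hX z hz
      (by rw [hb]; exact_mod_cast hpb) α
  · exact G.corrAct_primeCycle_mem_algebraicClasses_of_coheight_add_one_of_hodgeModel hG hH hM h11 hX z
      hz (Z.2 z hz0) hb (show b + 1 = p by omega) α hα hpp

/-- **The pieces `Z_i` of Laterveer's decomposition, from Hodge models** (`Z_i` supported in
`W'_i × W_i`, `dim W_i ≤ i ≤ n`, `dim W'_i ≤ n − i`): every class `α ∈ H²ᵖ(X(ℂ); ℂ)` of Hodge type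
`(p,p)` is mapped into `algebraicClasses X p` (vanishing case or support case over each prime cycle).
The variant of `corrAct_mem_algebraicClasses_of_product_support` with `hM` in place of `hpull`.
[cite: Vial2013, Thm 7.1 (i), proof p. 19] [cite: VoisinHodgeII2003, Thm. 10.29 and proof of Thm. 10.31] -/
theorem GysinFormalism.corrAct_mem_algebraicClasses_of_product_support_of_hodgeModel (G : GysinFormalism)
    (hH : Resolution.Hironaka1964_projective.{0})
    (hM : ∀ (m : ℕ) (Y : SchemeOver ℂ), nonempty_hodgeModel m Y) (hX : IsSmoothProjective n X)
    {Z : ↥(cyclesOfDim (X ⊗ X).left n)} {W W' : Set X.left} {i : ℕ} (hi : i ≤ n)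
    (hW : ∀ w ∈ W, Order.height w ≤ (i : ℕ)) (hW' : ∀ w ∈ W', Order.height w ≤ (n - i : ℕ))
    (hZ : ∀ z, (Z : AlgebraicCycle (X ⊗ X).left ℤ) z ≠ 0 →
      (fst X X).left.base z ∈ W' ∧ (snd X X).left.base z ∈ W)
    {p : ℕ} (α : complexBetti X (2 * p)) (hpp : IsOfHodgeType n X (2 * p) p p α) :
    G.corrAct hX hX (2 * p) Z α ∈ algebraicClasses X p := by
  refine G.corrAct_mem_of_primeCycle hX hX (2 * p) _ Z α fun z hz0 hz ↦ ?_
  by_cases hlt : Order.height ((snd X X).left.base z) < (p : ℕ∞)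
  · rw [G.corrAct_primeCycle_eq_zero_of_height_snd_lt_of_hodgeModel hH hM hX z hz (Z.2 z hz0) hlt α hpp]
    exact Submodule.zero_mem _
  · refine G.corrAct_primeCycle_mem_algebraicClasses_of_le_coheight hX z hz ?_ α
    obtain ⟨a, b, ha, hb, hab⟩ := exists_height_eq_coheight_eq hX ((fst X X).left.base z)
    obtain ⟨a₂, b₂, ha₂, -, hab₂⟩ := exists_height_eq_coheight_eq hX ((snd X X).left.base z)
    have h1 := hW' _ (hZ z hz0).1
    have h2 := hW _ (hZ z hz0).2
    rw [ha] at h1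
    rw [ha₂] at h2 hlt
    rw [hb]
    have h1' : a ≤ n - i := by exact_mod_cast h1
    have h2' : a₂ ≤ i := by exact_mod_cast h2
    have hlt' : p ≤ a₂ := by
      by_contra h
      exact hlt (by exact_mod_cast (not_le.mp h))
    exact_mod_cast (show p ≤ b by omega)

end PiecesOfHodgeModel

section AssemblyOfHodgeModel

variable {n : ℕ} {X : SchemeOver ℂ}

/-- **Laterveer's theorem below the middle degree (Step A), for a Hodge-compatible Gysin formalism,
from the named facts alone.** For a smooth projective complex `n`-fold `X` satisfying the Chow
hypothesis of `Vial2013_hodgeConjectureFor_of_chowGroups_rank_le_one`, every rational `(p,p)`-class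
`α ∈ H²ᵖ(X(ℂ); ℂ)` with `p ≤ ⌊(n−4)/2⌋ + 2` is algebraic (`m[Δ_X] ∼ Σ Z_i + Z'`, Lemma 9.18,
`[Δ_X]^* = Id`, the pieces `…_of_product_support_of_hodgeModel` and `…_of_fst_codim_of_hodgeModel`,
`m` invertible in `ℂ`). Hypotheses: `G`, `hG` and the named facts `hH`, `hM`, `h11`. The variant of
`mem_algebraicClasses_of_chowGroups_rank_le_one_of_le` without `hpull`, `hcupH`.
[cite: Vial2013, Thm 7.1 (i), proof p. 19] [cite: VoisinHodgeII2003, Thm. 10.29, Lemma 9.18 and proof of Prop. 10.26]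
[cite: Laterveer1998, main theorem, as quoted in Vial2013 Thm 7.1] -/
theorem mem_algebraicClasses_of_chowGroups_rank_le_one_of_le_of_hodgeModel (G : GysinFormalism)
    (hG : G.IsGysinHodgeCompatible) (hH : Resolution.Hironaka1964_projective.{0})
    (hM : ∀ (m : ℕ) (Y : SchemeOver ℂ), nonempty_hodgeModel m Y) (h11 : lefschetzOneOne_rational)
    (hX : IsSmoothProjective n X)
    (hCH : ∀ (L : Type) [Field L] [IsAlgClosed L] [Algebra ℂ L] (i : ℕ), i ≤ (n - 4) / 2 →
      ∀ a b : ChowGroup ((baseChange ℂ L).obj X).left i,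
        ∃ m n : ℤ, (m ≠ 0 ∨ n ≠ 0) ∧ m • a = n • b)
    {p : ℕ} (hp : p ≤ (n - 4) / 2 + 2) (α : complexBetti X (2 * p)) (hα : IsRationalClass α)
    (hpp : IsOfHodgeType n X (2 * p) p p α) : α ∈ algebraicClasses X p := by
  classical
  -- a generic point `δ` of the diagonal, and `[Δ]` as an `n`-cycle
  haveI := GysinFormalism.isClosedImmersion_diagonal_left hX
  haveI := irreducibleSpace_of_isSmoothProjective' hX
  set Δ := (lift (𝟙 X) (𝟙 X)).left with hΔ
  obtain ⟨δ, hδ⟩ : ∃ δ : ↥(X ⊗ X).left, IsGenericPoint δ (Set.range Δ.base) := by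
    refine ⟨Δ.base (genericPoint X.left), ?_⟩
    have h := (genericPoint_spec X.left).image Δ.base.hom.continuous
    rwa [Set.image_univ, Δ.isClosedEmbedding.isClosed_range.closure_eq] at h
  have hn : primeCycle δ ∈ cyclesOfDim (X ⊗ X).left n :=
    primeCycle_mem_cyclesOfDim (height_eq_of_isGenericPoint_diagonal' hX hδ)
  -- Laterveer's decomposition `m[Δ] ∼ Σ Z_i + Z'`
  obtain ⟨m, hm, T, -, hcod, Z', hZ', hZ'T, Z, W, W', hZ, -, hWdim, hW'dim, hsupp, hrat⟩ :=
    decompositionOfTheDiagonal_of_chowGroups_rank_le_one hX hCH δ hδ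
  set Zs : Fin ((n - 4) / 2 + 1) → ↥(cyclesOfDim (X ⊗ X).left n) := fun i ↦ ⟨Z i, hZ i⟩ with hZs
  have hrat' : IsRationallyEquivalent
      ((m • ⟨primeCycle δ, hn⟩ : ↥(cyclesOfDim (X ⊗ X).left n)) : AlgebraicCycle (X ⊗ X).left ℤ)
      (((∑ i, Zs i) + ⟨Z', hZ'⟩ : ↥(cyclesOfDim (X ⊗ X).left n)) : AlgebraicCycle (X ⊗ X).left ℤ) n := by
    rw [AddSubgroup.coe_add, AddSubmonoidClass.coe_finsetSum]
    exact hrat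
  -- Lemma 9.18 and `[Δ]^* = Id`: `m • α = Σ [Z_i]^*α + [Z']^*α`
  have hact := G.corrAct_congr hX hX (2 * p) hrat'
  rw [map_nsmul, map_add, map_sum, G.corrAct_primeCycle_diagonal hX (2 * p) δ hδ hn] at hact
  have hmα : (m : ℂ) • α = ∑ i, G.corrAct hX hX (2 * p) (Zs i) α + G.corrAct hX hX (2 * p) ⟨Z', hZ'⟩ α := by
    have h := LinearMap.congr_fun hact α
    simp only [LinearMap.smul_apply, LinearMap.id_apply, LinearMap.add_apply,
      LinearMap.coe_sum, Finset.sum_apply] at h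
    rw [← h, Nat.cast_smul_eq_nsmul ℂ m α]
  -- every summand is algebraic
  have hmem : (m : ℂ) • α ∈ algebraicClasses X p := by
    rw [hmα]
    refine add_mem (Submodule.sum_mem _ fun i _ ↦ ?_) ?_
    · exact G.corrAct_mem_algebraicClasses_of_product_support_of_hodgeModel hH hM hX (i := (i : ℕ))
        (by omega) (hWdim i) (hW'dim i) (hsupp i) α hpp
    · exact G.corrAct_mem_algebraicClasses_of_fst_codim_of_hodgeModel hG hH hM h11 hX
        (c₀ := (n - 4) / 2 + 1) (fun t ht ↦ by exact_mod_cast hcod t ht) hZ'T (by omega) α hα hpp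
  -- and `m` is invertible in `ℂ`
  have hm0 : (m : ℂ) ≠ 0 := by exact_mod_cast hm.ne'
  rwa [Submodule.smul_mem_iff _ hm0] at hmem

/-- **Laterveer's theorem in every degree (Steps A and B), from the named facts alone**: for
`2p ≤ n` Step A (`mem_algebraicClasses_of_chowGroups_rank_le_one_of_le_of_hodgeModel`); for `2p > n`
the hard Lefschetz theorem for `X` (`nonempty_hardLefschetzNFold n X`, `hHL`) reduces to codimension
`n − p`, `2(n−p) < n` (`mem_algebraicClasses_of_lt_of_nonempty`). The variant of
`mem_algebraicClasses_of_chowGroups_rank_le_one` without `hpull`, `hcupH`.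
[cite: Vial2013, Thm 7.1 (i), proof p. 19] [cite: VoisinHodgeI2002, Thm. 6.25 and Rem. 6.27]
[cite: Laterveer1998, main theorem, as quoted in Vial2013 Thm 7.1] -/
theorem mem_algebraicClasses_of_chowGroups_rank_le_one_of_hodgeModel (G : GysinFormalism)
    (hG : G.IsGysinHodgeCompatible) (hH : Resolution.Hironaka1964_projective.{0})
    (hM : ∀ (m : ℕ) (Y : SchemeOver ℂ), nonempty_hodgeModel m Y) (h11 : lefschetzOneOne_rational)
    (hX : IsSmoothProjective n X) (hHL : nonempty_hardLefschetzNFold n X)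
    (hCH : ∀ (L : Type) [Field L] [IsAlgClosed L] [Algebra ℂ L] (i : ℕ), i ≤ (n - 4) / 2 →
      ∀ a b : ChowGroup ((baseChange ℂ L).obj X).left i,
        ∃ m n : ℤ, (m ≠ 0 ∨ n ≠ 0) ∧ m • a = n • b)
    (p : ℕ) (α : complexBetti X (2 * p)) (hα : IsRationalClass α) (hpp : IsOfHodgeType n X (2 * p) p p α) :
    α ∈ algebraicClasses X p := by
  by_cases h2p : 2 * p ≤ n
  · exact mem_algebraicClasses_of_chowGroups_rank_le_one_of_le_of_hodgeModel G hG hH hM h11 hX hCH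
      (by omega) α hα hpp
  · exact mem_algebraicClasses_of_lt_of_nonempty hHL hX (by omega)
      (fun c hc hc' ↦ mem_algebraicClasses_of_chowGroups_rank_le_one_of_le_of_hodgeModel G hG hH hM h11
        hX hCH (by omega) c hc hc') α hα hpp

/-- **Assembly from the named facts: Vial 2013, Thm. 7.1 (i) / Laterveer 1998 on the tree's carriers,
`Vial2013_hodgeConjectureFor_of_chowGroups_rank_le_one`, follows from a Hodge-compatible Gysin /
cycle-class formalism and four named facts of the tree** — projective Hironaka
(`Resolution.Hironaka1964_projective`), Hodge models of smooth projective varieties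
(`nonempty_hodgeModel`, also the anti-vacuity conjunct of `HodgeConjectureFor`), the Lefschetz theorem
on `(1,1)`-classes (`lefschetzOneOne_rational`) and the hard Lefschetz theorem
(`nonempty_hardLefschetzNFold`) — the generalised decomposition of the diagonal being PROVED
(`Motives.ParanjapeLaterveer_generalisedDecompositionOfTheDiagonal_holds`) and "pull-backs preserve
Hodge types" being PROVED where it is used (`IsOfHodgeType.map_of_le`). `G : GysinFormalism` is a
hypothesis structure taken as a PARAMETER (its intended instance is to be supplied by a construction,
module docstring of `GysinFormalism`), of which only the Hodge compatibility of the Gysin morphisms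
is used (`G.IsGysinHodgeCompatible`: `f_*` rational and of bidegree `(dim X − dim Y, dim X − dim Y)`,
Voisin I §7.3.2 — no property of the cycle class beyond the fields of `G`). Nothing is asserted: the
unconditional discharge `…_holds` is this theorem applied to the four `…_holds` and the constructed `G`.
[cite: Vial2013, Thm 7.1 (i)] [cite: Laterveer1998, main theorem, as quoted in Vial2013 Thm 7.1]
[cite: VoisinHodgeII2003, Thm. 10.29, Thm. 10.31 and proof of Prop. 10.26] -/
theorem Vial2013_hodgeConjectureFor_of_chowGroups_rank_le_one_of_isGysinHodgeCompatible
    (G : GysinFormalism) (hG : G.IsGysinHodgeCompatible) (hH : Resolution.Hironaka1964_projective.{0})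
    (hM : ∀ (m : ℕ) (Y : SchemeOver ℂ), nonempty_hodgeModel m Y) (h11 : lefschetzOneOne_rational)
    (hHL : ∀ (m : ℕ) (Y : SchemeOver ℂ), nonempty_hardLefschetzNFold m Y) :
    Vial2013_hodgeConjectureFor_of_chowGroups_rank_le_one := by
  intro d X hX hCH
  exact ⟨hM d X hX, fun p α hα hpp ↦ mem_algebraicClasses_of_chowGroups_rank_le_one_of_hodgeModel G hG hH
    hM h11 hX (hHL d X) hCH p α hα hpp⟩

/-- The same assembly for a Hodge-compatible formalism (`G.IsHodgeCompatible`, the predicate carried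
by the degree-`4` consumers; it implies `G.IsGysinHodgeCompatible`). [cite: Vial2013, Thm 7.1 (i)]
[cite: Laterveer1998, main theorem, as quoted in Vial2013 Thm 7.1] -/
theorem Vial2013_hodgeConjectureFor_of_chowGroups_rank_le_one_of_isHodgeCompatible (G : GysinFormalism)
    (hG : G.IsHodgeCompatible) (hH : Resolution.Hironaka1964_projective.{0})
    (hM : ∀ (m : ℕ) (Y : SchemeOver ℂ), nonempty_hodgeModel m Y) (h11 : lefschetzOneOne_rational)
    (hHL : ∀ (m : ℕ) (Y : SchemeOver ℂ), nonempty_hardLefschetzNFold m Y) :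
    Vial2013_hodgeConjectureFor_of_chowGroups_rank_le_one :=
  Vial2013_hodgeConjectureFor_of_chowGroups_rank_le_one_of_isGysinHodgeCompatible G
    hG.isGysinHodgeCompatible hH hM h11 hHL

end AssemblyOfHodgeModel

end Literature.AlgebraicGeometry.HodgeTheory

end
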